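import Summits.QuantumFields.YangMills.Theorems.UnitScaleTiltProp7LocMinOfJointRow
import Summits.QuantumFields.YangMills.Theorems.UnitScaleTiltProp7FirstVariationMultiplierBoundWeakEL
import Summits.QuantumFields.YangMills.Theorems.UnitScaleTiltProp7CurvedLandauRowA
import Summits.QuantumFields.YangMills.Theorems.UnitScaleTiltMinimiserStabilityRegPrPV3EChart
import Summits.QuantumFields.YangMills.Theorems.UnitScaleTiltProp7SPrintIn19Dict
import HarnessLib

/-!
# Route `UnitScaleTilt`, crux K1 child «MinimiserStabilityRegPr» (stmt-QuantumFields-19200) — `hcoW` OF THE EX KNIT OF RECORD v3.2ˢ FROM THE Q-ROWS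
# (the EX twin of ★p1-19200 g13's ✓`Prop7LocMinOfMultiplierRows`; named (o2) by ★p1 g13 2026-08-28 13:39Z)

Cell `ym3-torus`, width seat `ym-ust-19200-w4` (gen 4).  THEOREMS ONLY (0 `def`, 0 `sorry`).  YM₃ on T³ is a ladder rung (R3), not the Clay problem; nothing here
claims the stub, the crux, d = 4 or the mass gap.

WHAT IS PROVED (ns `…Theorems.Prop7HcoWOfQRows`).  ★★★ `hcoW_of_QRowsW`: HYPOTHESIS = the binder prefix of `hcoW` (✓`Prop7StubEXOfChartPiecesTwS5.stubEX_of_chartPiecesTwS5` ∕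
✓`…TwS4`) VERBATIM — member, radii, `W ∈ (6)(e) ∩ 𝔅_k(V)`, the E–L clause over `𝔅_k(V)`, `RestrictedPrint`, self-adjoint chart coordinate `A` with `U₁ = e^{iηA}`,
(136)∕(138)∕(139), the moved competitor in (6)(e) — concluding, for the direction `D := η·A`, the Q-ROWS of ★p1's E′ door: a sup-radius `s` (`4s ≤ 1`), HESS_W′
`κ·Σ‖ηA‖² ≤ Σ_p‖ℒ_p(ηA)‖²`, the JOINT remainder row `Σ_c‖(Q (K−n) (iηA))(c)‖ ≤ C₁ℓ⁻¹·Σ‖ηA‖² + C₂ℓ·Σ_p‖ℒ_p(ηA)‖²` for EVERY recursion family `Q` of the true one-step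
linearisations along `W`'s tower (the letters of ✓`Prop7FirstVariationExactPairing` ∕ ✓`Prop7LocMinOfMultiplierRows`, `U₀ := W`), and the window `2eC₂ ≤ ⅛`,
`2eC₁ℓ⁻² + 15552s² + 216·regThreshold(e) ≤ κ∕8` at the competitor radius `e`; CONCLUSION = `hcoW` VERBATIM.  PROOF: `e₇` is shrunk to `min e₇ (10¹⁰L⁶)⁻¹`; the
first-variation bound in the `Q`-currency AT AN E–L-CRITICAL POINT is ★routeR-w2 g2's ✓`Prop7FirstVariationMultiplierBoundWeakEL.abs_lin_le_sum_norm_trueLinIter_weakEL`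
fed by ✓`Prop7FirstVariationWeakEL.weakEL_of_fibreEL` (the knit's clause ⟹ the weak letter) at `A := I•(η•A)` (skew-adjoint, traceless: the two-line facts of ★p1's ✓`I_smul_mem_skewAdjoint` ∕
✓`trace_I_smul_eq_zero`, inlined), `Q` from ✓`Prop7CurvedLandauRowA.exists_trueLinIter_family`; then ✓`Prop7LocMinOfJointRow.linRow_of_QRows` and the Taylor door
✓`wilsonAction4_le_expChart_of_linRow`, with `U₁ = expHermField(η·A)` as in ✓`Prop7HcoWOfJointRows`.

HONEST SCOPE.  Bookkeeping over landed letters: the HESS_W′ row ((H1) ✓`Prop7HessWOfFibreCoreT3` on the Landau slice) and the JOINT remainder row (N3b) remain the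
displayed suppliers; nothing of print is asserted.  `--supports stmt-QuantumFields-19200`, count-neutral.

References: T. Bałaban, CMP 102 (1985) 277–309 [Balaban1985Variational] ((2), (6) p.278, (47)–(49) pp.285–286, (112) p.294, (116) p.295, (136)–(143) pp.298–299,
Prop. 7 p.299); CMP 99 (1985) 389–434 [Balaban1985BackgroundPropagators] ((3.11) p.392); CMP 98 (1985) 17–51 [Balaban1985Averaging] ((11) p.19).
-/

set_option autoImplicit false
noncomputable section

open scoped BigOperators Matrix.Norms.L2Operator Matrix Topology
open Filter NormedSpace

namespace Summit.QuantumFields.YangMills.Theorems.Prop7HcoWOfQRows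

open Literature.MathematicalPhysics.QuantumFieldTheory.Balaban1983to89
open Literature.MathematicalPhysics.QuantumFieldTheory.Balaban1983to89.T3ContinuumYM3Torus
open Literature.MathematicalPhysics.QuantumFieldTheory.Balaban1983to89.T3UnitLawDensityEML (ℰp)
open Literature.MathematicalPhysics.QuantumFieldTheory.Balaban1983to89.T3ConstrainedMinimiser (fibre)
open Literature.MathematicalPhysics.QuantumFieldTheory.Balaban1983to89.T3PrintedRegularMinimiser
open Literature.MathematicalPhysics.QuantumFieldTheory.Balaban1983to89.T3RegularMinimiser
open Literature.MathematicalPhysics.QuantumFieldTheory.Balaban1983to89.T3Thm1Carrier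
open T4Continuum BlockAveraging AveragingRT ExpMeanLog BlockAveragingEMLLinearised BlockAveragingEMLLinearisedBackground BlockAveragingEMLProp2
open B10Eq27TorusAxialLog (pull)
open T3SectALandauChart (emb15 eta bgUnits pos_of_regPr)
open Summit.QuantumFields.YangMills.Theorems.Prop7SPrint (basePt RestrictedPrint)
open Summit.QuantumFields.YangMills.Theorems.Prop7TPrint (expHerm expHermField expHermField_apply coe_expHerm)
open Summit.QuantumFields.YangMills.Theorems.Prop7SPrintIn19 (trace_eq_zero_of_exp_mem_SU2)
open Summit.QuantumFields.YangMills.Theorems.Prop7LocMinOfJointRow (wilsonAction4_le_expChart_of_linRow linRow_of_QRows)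
open Summit.QuantumFields.YangMills.Theorems.Prop7CurvedLandauRowA (exists_trueLinIter_family)
open Summit.QuantumFields.YangMills.Theorems.Prop7FirstVariationWeakEL (weakEL_of_fibreEL)
open Summit.QuantumFields.YangMills.Theorems.Prop7FirstVariationMultiplierBoundWeakEL (abs_lin_le_sum_norm_trueLinIter_weakEL)

/-- ★★★ **`hcoW` OF THE EX KNIT v3.2ˢ FROM THE Q-ROWS AT THE E–L-CRITICAL CHART BACKGROUND.**  See the module docstring. [cite: Balaban1985Variational, (141)-(143) p.299, (116) p.295, (47)-(49) pp.285-286, (112) p.294, (2), (6) p.278; Balaban1985BackgroundPropagators, (3.11) p.392] -/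
theorem hcoW_of_QRowsW
    (hQW : ∀ (L : ℕ), 1 < L → ∀ (B₁ : ℝ), 0 < B₁ → ∃ e₇ c₇ : ℝ, 0 < e₇ ∧ 0 < c₇ ∧
      ∀ (F : T3Family), F.L = L → ∀ (n K : ℕ) (hnK : n < K) (e α : ℝ) (V : GaugeField (F.P n) 0 (Matrix.specialUnitaryGroup (Fin 2) ℂ))
        (W U₁ : GaugeField (F.P K) 0 (Matrix.specialUnitaryGroup (Fin 2) ℂ)) (u : GaugeTransf (F.P K) 0 (Matrix.specialUnitaryGroup (Fin 2) ℂ))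
        (A : PBond (F.P K) 0 → Matrix (Fin 2) (Fin 2) ℂ),
        0 < e → e ≤ e₇ → 0 < α → α ≤ c₇ → W ∈ regFibrePr F n K hnK.le e V →
        (∀ γ : ℝ → GaugeField (F.P K) 0 (Matrix.specialUnitaryGroup (Fin 2) ℂ), γ 0 = W → (∀ t, γ t ∈ fibre F ℰp n K hnK.le V) →
          (∀ b, DifferentiableAt ℝ (fun t => ((γ t b : Matrix.specialUnitaryGroup (Fin 2) ℂ) : Matrix (Fin 2) (Fin 2) ℂ)) 0) →
            deriv (fun t => wilsonAction4 (γ t)) 0 = 0) →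
        RestrictedPrint F n K W u → (∀ b : PBond (F.P K) 0, IsSelfAdjoint (A b)) →
        (∀ b : PBond (F.P K) 0, ((U₁ b : Matrix.specialUnitaryGroup (Fin 2) ℂ) : Matrix (Fin 2) (Fin 2) ℂ) = exp (Complex.I • ((eta F n K) • A b))) →
        (∃ (β₀ B₂ : ℝ) (len : B7Prop1Explicit.Site (F.P K).d → ℝ),
          B8Thm2TorusAt.C136T (F.P K).L (K - n) (eta F n K) β₀ B₁ B₂ len α (pull (bgUnits F K W) (basePt F n K)) (pull A (basePt F n K))) →
        B8Eq138LandauZd.IsLandau138 (F.P K).L (K - n) (eta F n K) (Set.univ : Set (B7Prop1Explicit.Site (F.P K).d)) (B8Thm4TorusAt.torusLam (K - n))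
          (pull (bgUnits F K W) (basePt F n K)) (pull A (basePt F n K)) →
        B8Thm2TorusAt.C139T (F.P K).L (K - n) (eta F n K) B₁ α (pull (bgUnits F K W) (basePt F n K)) (pull A (basePt F n K)) →
        GaugeField.gaugeAct u (emb15 W U₁) ∈ regFibrePr F n K hnK.le e V →
          ∃ s κ C₁ C₂ : ℝ, (∀ b : PBond (F.P K) 0, ‖(eta F n K • A) b‖ ≤ s) ∧ 4 * s ≤ 1 ∧
            κ * ∑ b : PBond (F.P K) 0, ‖(eta F n K • A) b‖ ^ 2 ≤ ∑ p : Plaq (F.P K) 0, ‖((Complex.I • (eta F n K • A) ⟨p.src, p.μ⟩) + ((W ⟨p.src, p.μ⟩ : Matrix (Fin 2) (Fin 2) ℂ) * (Complex.I • (eta F n K • A) ⟨p.src.shift p.μ, p.ν⟩) * star (W ⟨p.src, p.μ⟩ : Matrix (Fin 2) (Fin 2) ℂ))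
            - (((W ⟨p.src, p.μ⟩ * W ⟨p.src.shift p.μ, p.ν⟩ * (W ⟨p.src.shift p.ν, p.μ⟩)⁻¹ : Matrix.specialUnitaryGroup (Fin 2) ℂ) : Matrix (Fin 2) (Fin 2) ℂ) * (Complex.I • (eta F n K • A) ⟨p.src.shift p.ν, p.μ⟩) * star ((W ⟨p.src, p.μ⟩ * W ⟨p.src.shift p.μ, p.ν⟩ * (W ⟨p.src.shift p.ν, p.μ⟩)⁻¹ : Matrix.specialUnitaryGroup (Fin 2) ℂ) : Matrix (Fin 2) (Fin 2) ℂ))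
            - (((GaugeField.plaqHol W p : Matrix.specialUnitaryGroup (Fin 2) ℂ) : Matrix (Fin 2) (Fin 2) ℂ) * (Complex.I • (eta F n K • A) ⟨p.src, p.ν⟩) * star ((GaugeField.plaqHol W p : Matrix.specialUnitaryGroup (Fin 2) ℂ) : Matrix (Fin 2) (Fin 2) ℂ)))‖ ^ 2 ∧
            (∀ (Q : (k : ℕ) → (PBond (F.P K) 0 → Matrix (Fin 2) (Fin 2) ℂ) → PBond (F.P K) k → Matrix (Fin 2) (Fin 2) ℂ), (∀ Y, Q 0 Y = Y) →
        (∀ (k : ℕ) (Y : PBond (F.P K) 0 → Matrix (Fin 2) (Fin 2) ℂ) (c : PBond (F.P K) (k + 1)), Q (k + 1) Y c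
          = fderiv ℂ (eml : (Idx (F.P K) → Matrix (Fin 2) (Fin 2) ℂ) → Matrix (Fin 2) (Fin 2) ℂ)
              (fun i => ((loopHol (Averaging.iter (fun i => blockAvg (P := F.P K) (j := i) (expMeanLogSU (n := Fin 2))) k W) c i :
                Matrix.specialUnitaryGroup (Fin 2) ℂ) : Matrix (Fin 2) (Fin 2) ℂ))
              (fun i => covWalkSum (Averaging.iter (fun i => blockAvg (P := F.P K) (j := i) (expMeanLogSU (n := Fin 2))) k W) (Q k Y)
                  (walk (emb c.src) (loopWord (F.P K).L c.dir (off i.1) i.2.1 i.2.2))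
                * ((loopHol (Averaging.iter (fun i => blockAvg (P := F.P K) (j := i) (expMeanLogSU (n := Fin 2))) k W) c i :
                  Matrix.specialUnitaryGroup (Fin 2) ℂ) : Matrix (Fin 2) (Fin 2) ℂ))
              * star ((corr (expMeanLogSU (n := Fin 2)) (Averaging.iter (fun i => blockAvg (P := F.P K) (j := i) (expMeanLogSU (n := Fin 2))) k W) c :
                  Matrix.specialUnitaryGroup (Fin 2) ℂ) : Matrix (Fin 2) (Fin 2) ℂ)
            + ((corr (expMeanLogSU (n := Fin 2)) (Averaging.iter (fun i => blockAvg (P := F.P K) (j := i) (expMeanLogSU (n := Fin 2))) k W) c :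
                  Matrix.specialUnitaryGroup (Fin 2) ℂ) : Matrix (Fin 2) (Fin 2) ℂ)
              * covWalkSum (Averaging.iter (fun i => blockAvg (P := F.P K) (j := i) (expMeanLogSU (n := Fin 2))) k W) (Q k Y)
                  (walk (emb c.src) (List.replicate (F.P K).L (c.dir, true)))
              * star ((corr (expMeanLogSU (n := Fin 2)) (Averaging.iter (fun i => blockAvg (P := F.P K) (j := i) (expMeanLogSU (n := Fin 2))) k W) c :
                  Matrix.specialUnitaryGroup (Fin 2) ℂ) : Matrix (Fin 2) (Fin 2) ℂ)) →
            ∑ c : PBond (F.P K) (K - n), ‖Q (K - n) (fun b => Complex.I • (eta F n K • A) b) c‖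
              ≤ C₁ * ((F.L : ℝ) ^ (K - n))⁻¹ * ∑ b : PBond (F.P K) 0, ‖(eta F n K • A) b‖ ^ 2
                + C₂ * (F.L : ℝ) ^ (K - n) * ∑ p : Plaq (F.P K) 0, ‖((Complex.I • (eta F n K • A) ⟨p.src, p.μ⟩) + ((W ⟨p.src, p.μ⟩ : Matrix (Fin 2) (Fin 2) ℂ) * (Complex.I • (eta F n K • A) ⟨p.src.shift p.μ, p.ν⟩) * star (W ⟨p.src, p.μ⟩ : Matrix (Fin 2) (Fin 2) ℂ))
            - (((W ⟨p.src, p.μ⟩ * W ⟨p.src.shift p.μ, p.ν⟩ * (W ⟨p.src.shift p.ν, p.μ⟩)⁻¹ : Matrix.specialUnitaryGroup (Fin 2) ℂ) : Matrix (Fin 2) (Fin 2) ℂ) * (Complex.I • (eta F n K • A) ⟨p.src.shift p.ν, p.μ⟩) * star ((W ⟨p.src, p.μ⟩ * W ⟨p.src.shift p.μ, p.ν⟩ * (W ⟨p.src.shift p.ν, p.μ⟩)⁻¹ : Matrix.specialUnitaryGroup (Fin 2) ℂ) : Matrix (Fin 2) (Fin 2) ℂ))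
            - (((GaugeField.plaqHol W p : Matrix.specialUnitaryGroup (Fin 2) ℂ) : Matrix (Fin 2) (Fin 2) ℂ) * (Complex.I • (eta F n K • A) ⟨p.src, p.ν⟩) * star ((GaugeField.plaqHol W p : Matrix.specialUnitaryGroup (Fin 2) ℂ) : Matrix (Fin 2) (Fin 2) ℂ)))‖ ^ 2) ∧
            2 * e * C₂ ≤ 1 / 8 ∧
            2 * e * C₁ * (((F.L : ℝ) ^ (K - n)) ^ 2)⁻¹ + 15552 * s ^ 2 + 216 * regThreshold F n K e ≤ κ / 8) :
    ∀ (L : ℕ), 1 < L → ∀ (B₁ : ℝ), 0 < B₁ → ∃ e₇ c₇ : ℝ, 0 < e₇ ∧ 0 < c₇ ∧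
      ∀ (F : T3Family), F.L = L → ∀ (n K : ℕ) (hnK : n < K) (e α : ℝ) (V : GaugeField (F.P n) 0 (Matrix.specialUnitaryGroup (Fin 2) ℂ))
        (W U₁ : GaugeField (F.P K) 0 (Matrix.specialUnitaryGroup (Fin 2) ℂ)) (u : GaugeTransf (F.P K) 0 (Matrix.specialUnitaryGroup (Fin 2) ℂ))
        (A : PBond (F.P K) 0 → Matrix (Fin 2) (Fin 2) ℂ),
        0 < e → e ≤ e₇ → 0 < α → α ≤ c₇ → W ∈ regFibrePr F n K hnK.le e V →
        (∀ γ : ℝ → GaugeField (F.P K) 0 (Matrix.specialUnitaryGroup (Fin 2) ℂ), γ 0 = W → (∀ t, γ t ∈ fibre F ℰp n K hnK.le V) →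
          (∀ b, DifferentiableAt ℝ (fun t => ((γ t b : Matrix.specialUnitaryGroup (Fin 2) ℂ) : Matrix (Fin 2) (Fin 2) ℂ)) 0) →
            deriv (fun t => wilsonAction4 (γ t)) 0 = 0) →
        RestrictedPrint F n K W u → (∀ b : PBond (F.P K) 0, IsSelfAdjoint (A b)) →
        (∀ b : PBond (F.P K) 0, ((U₁ b : Matrix.specialUnitaryGroup (Fin 2) ℂ) : Matrix (Fin 2) (Fin 2) ℂ) = exp (Complex.I • ((eta F n K) • A b))) →
        (∃ (β₀ B₂ : ℝ) (len : B7Prop1Explicit.Site (F.P K).d → ℝ),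
          B8Thm2TorusAt.C136T (F.P K).L (K - n) (eta F n K) β₀ B₁ B₂ len α (pull (bgUnits F K W) (basePt F n K)) (pull A (basePt F n K))) →
        B8Eq138LandauZd.IsLandau138 (F.P K).L (K - n) (eta F n K) (Set.univ : Set (B7Prop1Explicit.Site (F.P K).d)) (B8Thm4TorusAt.torusLam (K - n))
          (pull (bgUnits F K W) (basePt F n K)) (pull A (basePt F n K)) →
        B8Thm2TorusAt.C139T (F.P K).L (K - n) (eta F n K) B₁ α (pull (bgUnits F K W) (basePt F n K)) (pull A (basePt F n K)) →
        GaugeField.gaugeAct u (emb15 W U₁) ∈ regFibrePr F n K hnK.le e V →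
          wilsonAction4 W ≤ wilsonAction4 (emb15 W U₁) := by
  intro L hL B₁ hB₁
  obtain ⟨e₇, c₇, he₇, hc₇, H⟩ := hQW L hL B₁ hB₁
  have hL0 : (0 : ℝ) < (L : ℝ) := by exact_mod_cast (show 0 < L by omega)
  have hbig : (0 : ℝ) < 10 ^ 10 * (L : ℝ) ^ 6 := by positivity
  refine ⟨min e₇ (10 ^ 10 * (L : ℝ) ^ 6)⁻¹, c₇, lt_min he₇ (inv_pos.mpr hbig), hc₇, ?_⟩
  intro F hF n K hnK e α V W U₁ u A he heε hα hαc hWreg hEL hRP hA hU₁ h136 h138 h139 hmem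
  have he₇ : e ≤ e₇ := heε.trans (min_le_left _ _)
  have heL : 10 ^ 10 * (F.L : ℝ) ^ 6 * e ≤ 1 := by
    rw [hF]
    have h1 : e ≤ (10 ^ 10 * (L : ℝ) ^ 6)⁻¹ := heε.trans (min_le_right _ _)
    calc 10 ^ 10 * (L : ℝ) ^ 6 * e ≤ 10 ^ 10 * (L : ℝ) ^ 6 * (10 ^ 10 * (L : ℝ) ^ 6)⁻¹ := mul_le_mul_of_nonneg_left h1 hbig.le
      _ = 1 := mul_inv_cancel₀ hbig.ne'
  obtain ⟨s, κ, C₁, C₂, hDs, hs4, hq, hJ, hw₁, hw₂⟩ :=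
    H F hF n K hnK e α V W U₁ u A he he₇ hα hαc hWreg hEL hRP hA hU₁ h136 h138 h139 hmem
  -- the direction `D := η·A` is Hermitian-traceless, so `U₁ = expHermField (η·A)` and `I•D` is `𝔰𝔲(2)`-valued
  have hDh : ∀ b : PBond (F.P K) 0, ((eta F n K • A) b).IsHermitian ∧ Matrix.trace ((eta F n K • A) b) = 0 := fun b => by
    have hmemb : exp (Complex.I • ((eta F n K) • A b)) ∈ Matrix.specialUnitaryGroup (Fin 2) ℂ := hU₁ b ▸ (U₁ b).prop
    exact ⟨(IsSelfAdjoint.all (eta F n K)).smul (hA b), trace_eq_zero_of_exp_mem_SU2 hmemb ((hDs b).trans (by linarith))⟩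
  have hU₁eq : U₁ = expHermField (eta F n K • A) := by
    funext b
    apply Subtype.ext
    rw [hU₁ b, expHermField_apply, coe_expHerm (hDh b)]
    rfl
  obtain ⟨hWfib, hreg⟩ := (mem_regFibrePr_iff F).mp hWreg
  -- a recursion family of the true linearisations along `W`'s tower, and (141) in the `Q`-currency at the E–L-critical `W`
  obtain ⟨Q, hQ0, hQs⟩ := exists_trueLinIter_family (N := 2) W
  have hELQ := abs_lin_le_sum_norm_trueLinIter_weakEL F hnK.le hWfib (weakEL_of_fibreEL F hnK.le hEL) he heL hreg Q hQ0 hQs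
    (fun b => Complex.I • (eta F n K • A) b)
    (fun b => by
      rw [skewAdjoint.mem_iff, star_smul, Complex.star_def, Complex.conj_I, Matrix.star_eq_conjTranspose, (hDh b).1.eq, neg_smul])
    (fun b => by rw [Matrix.trace_smul, (hDh b).2, smul_zero])
  have hlin := linRow_of_QRows F he.le W (eta F n K • A) hELQ (hJ Q hQ0 hQs) hq hw₁ hw₂
  rw [hU₁eq]
  exact wilsonAction4_le_expChart_of_linRow F hreg (eta F n K • A) hDh hDs hs4 hlin

end Summit.QuantumFields.YangMills.Theorems.Prop7HcoWOfQRows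

end
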